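import Literature.NumberTheory.Automorphic.GLnAdelicStructureProofs
import Literature.NumberTheory.Automorphic.ReductiveGroupData
import Literature.NumberTheory.Automorphic.AdicCompletionLocalField
import Mathlib.Topology.Algebra.RestrictedProduct.TopologicalSpace
import HarnessLib

/-!
# `GL_n(𝔸_K^∞)` is the restricted product of the `GL_n(K_v)` with respect to the `GL_n(𝒪_v)`

For a number field `K`: the finite adele ring is Mathlib's restricted product
`𝔸_K^∞ = Πʳ_v [K_v, 𝒪_v]`, and evaluation of the entries at each finite place gives a group
isomorphism

  `GLn.restrictedPiEquiv n K : GL_n(𝔸_K^∞) ≃* Πʳ_v [GL_n(K_v), GL_n(𝒪_v)]`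

(`GLn.toRestrictedPi`, components `GLn.evalAt n K v = GL_n(eval_v)`; the inverse assembles the
entries of the local matrices and of their inverses into finite adeles), which is moreover a
homeomorphism (`GLn.continuous_toRestrictedPi`, `GLn.isOpenMap_toRestrictedPi`,
`GLn.continuous_restrictedPiEquiv_symm`, `GLn.isOpenMap_restrictedPiEquiv_symm`): on the compact open
subgroup `GL_n(𝒪̂_K) = ∏_v GL_n(𝒪_v)` it is the structure map of the restricted product composed
with the continuous bijection `GL_n(𝒪̂_K) → ∏_v GL_n(𝒪_v)` of a compact group onto a Hausdorff one.
This is the standard description `G(𝔸_f) = ∏'_v G(K_v)` (Borel–Jacquet (1979), §4.1;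
Platonov–Rapinchuk (1994), §5.1; Bump (1997), §3.3) on which Flath's tensor product theorem
(`flath_exists_holds_of_isTopologicalGroup`) is applied to representations of `GL_n(𝔸_K^∞)`.
Definitions with bodies and theorems; no named fact.

## References

* A. Borel, H. Jacquet, *Automorphic forms and automorphic representations*, Corvallis 1979,
  part 1, §4.1.
* V. Platonov, A. Rapinchuk, *Algebraic groups and number theory* (1994), §5.1.
* D. Bump, *Automorphic forms and representations* (1997), §3.3.
-/

noncomputable section

open NumberField IsDedekindDomain Set Filter Topology
open scoped MatrixGroups RestrictedProduct

namespace Literature.NumberTheory.Automorphic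

variable (n : ℕ) (K : Type) [Field K] [NumberField K]

/-! ### 1. Evaluation of `GL_n(𝔸_K^∞)` at a finite place -/

/-- **Evaluation at `v`**: `GL_n(𝔸_K^∞) →* GL_n(K_v)` (`GL_n` of the projection `𝔸_K^∞ → K_v`).
[folklore] -/
def GLn.evalAt (v : HeightOneSpectrum (𝓞 K)) :
    GL (Fin n) (FiniteAdeleRing (𝓞 K) K) →* GL (Fin n) (v.adicCompletion K) :=
  Matrix.GeneralLinearGroup.map (AdelicGroupData.finiteAdeleEval K v)

variable {n K}

/-- Entries of `GLn.evalAt v y`: `(y_{ij})_v`. [folklore] -/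
@[simp] theorem GLn.coe_evalAt_apply (v : HeightOneSpectrum (𝓞 K)) (y : GL (Fin n) (FiniteAdeleRing (𝓞 K) K))
    (i j : Fin n) :
    (GLn.evalAt n K v y : Matrix (Fin n) (Fin n) (v.adicCompletion K)) i j =
      ((y : Matrix (Fin n) (Fin n) (FiniteAdeleRing (𝓞 K) K)) i j) v := rfl

/-- `GLn.evalAt v` is continuous. [folklore] -/
theorem GLn.continuous_evalAt (v : HeightOneSpectrum (𝓞 K)) : Continuous (GLn.evalAt n K v) :=
  (AdelicGroupData.continuous_finiteAdeleEval K v).generalLinearGroup_map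

/-- Membership in `𝒪[K_v]` (the valuation ring of the `ValuativeRel` structure) is membership in
Mathlib's `𝒪_v = v.adicCompletionIntegers K` (both are `|x|_v ≤ 1`); a private copy of the lemma of
`IwasawaDecompositionAdelic` (not imported: it sits on the reduction theory). [folklore] -/
private theorem mem_integer_iff_mem_adicCompletionIntegers' (v : HeightOneSpectrum (𝓞 K)) {x : v.adicCompletion K} :
    x ∈ (ValuativeRel.valuation (v.adicCompletion K)).integer ↔ x ∈ v.adicCompletionIntegers K := by
  rw [Valuation.mem_integer_iff, HeightOneSpectrum.mem_adicCompletionIntegers]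
  exact (ValuativeRel.isEquiv (ValuativeRel.valuation (v.adicCompletion K))
    (Valued.v : Valuation (v.adicCompletion K) _)).le_one_iff_le_one

/-- **`GLn.evalAt v y ∈ GL_n(𝒪_v)` iff the `v`-components of the entries of `y` and `y⁻¹` are
integral.** [folklore] -/
theorem GLn.evalAt_mem_glInt_iff (v : HeightOneSpectrum (𝓞 K)) (y : GL (Fin n) (FiniteAdeleRing (𝓞 K) K)) :
    GLn.evalAt n K v y ∈ glInt n (v.adicCompletion K) ↔
      (∀ i j, ((y : Matrix (Fin n) (Fin n) (FiniteAdeleRing (𝓞 K) K)) i j) v ∈ v.adicCompletionIntegers K) ∧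
        ∀ i j, (((y⁻¹ : GL (Fin n) (FiniteAdeleRing (𝓞 K) K)) : Matrix (Fin n) (Fin n)
          (FiniteAdeleRing (𝓞 K) K)) i j) v ∈ v.adicCompletionIntegers K := by
  rw [mem_glInt_iff]
  simp only [← map_inv, GLn.coe_evalAt_apply, mem_integer_iff_mem_adicCompletionIntegers']

/-- **Almost all components are integral**: `GLn.evalAt v y ∈ GL_n(𝒪_v)` for all but finitely many
`v` (each of the finitely many entries of `y` and `y⁻¹` is a finite adele). [folklore] -/
theorem GLn.eventually_evalAt_mem_glInt (y : GL (Fin n) (FiniteAdeleRing (𝓞 K) K)) :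
    ∀ᶠ v in cofinite, GLn.evalAt n K v y ∈ glInt n (v.adicCompletion K) := by
  simp only [GLn.evalAt_mem_glInt_iff, eventually_and, eventually_all]
  exact ⟨fun i j => ((y : Matrix (Fin n) (Fin n) (FiniteAdeleRing (𝓞 K) K)) i j).eventually,
    fun i j => (((y⁻¹ : GL (Fin n) (FiniteAdeleRing (𝓞 K) K)) : Matrix (Fin n) (Fin n)
      (FiniteAdeleRing (𝓞 K) K)) i j).eventually⟩

variable (n K)

/-! ### 2. The isomorphism `GL_n(𝔸_K^∞) ≃* Πʳ_v [GL_n(K_v), GL_n(𝒪_v)]` -/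

/-- **`GL_n(𝔸_K^∞) → Πʳ_v [GL_n(K_v), GL_n(𝒪_v)]`, `y ↦ (y_v)_v`.** [folklore] -/
def GLn.toRestrictedPi : GL (Fin n) (FiniteAdeleRing (𝓞 K) K) →*
    Πʳ v : HeightOneSpectrum (𝓞 K), [GL (Fin n) (v.adicCompletion K), glInt n (v.adicCompletion K)] where
  toFun y := RestrictedProduct.mk (fun v => GLn.evalAt n K v y) (GLn.eventually_evalAt_mem_glInt y)
  map_one' := RestrictedProduct.ext _ _ fun v => by
    rw [RestrictedProduct.mk_apply, RestrictedProduct.one_apply, map_one]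
  map_mul' x y := RestrictedProduct.ext _ _ fun v => by
    rw [RestrictedProduct.mk_apply, RestrictedProduct.mul_apply, RestrictedProduct.mk_apply,
      RestrictedProduct.mk_apply, map_mul]

variable {n K}

/-- Components of `GLn.toRestrictedPi`. [folklore] -/
@[simp] theorem GLn.toRestrictedPi_apply (y : GL (Fin n) (FiniteAdeleRing (𝓞 K) K)) (v : HeightOneSpectrum (𝓞 K)) :
    GLn.toRestrictedPi n K y v = GLn.evalAt n K v y := rfl

/-- Entries of members of `GL_n(𝒪_v)` and of their inverses are integral. [folklore] -/
theorem GLn.entries_mem_of_mem_glInt (v : HeightOneSpectrum (𝓞 K)) {g : GL (Fin n) (v.adicCompletion K)}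
    (hg : g ∈ glInt n (v.adicCompletion K)) :
    (∀ i j, (g : Matrix (Fin n) (Fin n) (v.adicCompletion K)) i j ∈ v.adicCompletionIntegers K) ∧
      ∀ i j, ((g⁻¹ : GL (Fin n) (v.adicCompletion K)) : Matrix (Fin n) (Fin n) (v.adicCompletion K)) i j ∈
        v.adicCompletionIntegers K := by
  rw [mem_glInt_iff] at hg
  exact ⟨fun i j => (mem_integer_iff_mem_adicCompletionIntegers' v).1 (hg.1 i j),
    fun i j => (mem_integer_iff_mem_adicCompletionIntegers' v).1 (hg.2 i j)⟩

/-- The finite adele with components the `(i, j)` entries of a restricted family of local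
matrices. [folklore] -/
def GLn.entryAdele (x : Πʳ v : HeightOneSpectrum (𝓞 K), [GL (Fin n) (v.adicCompletion K), glInt n (v.adicCompletion K)])
    (i j : Fin n) : FiniteAdeleRing (𝓞 K) K :=
  RestrictedProduct.mk (fun v => (x v : Matrix (Fin n) (Fin n) (v.adicCompletion K)) i j) (by
    filter_upwards [x.eventually] with v hv
    exact (GLn.entries_mem_of_mem_glInt v hv).1 i j)

/-- The finite adele with components the `(i, j)` entries of the inverses of a restricted family of
local matrices. [folklore] -/
def GLn.entryAdeleInv (x : Πʳ v : HeightOneSpectrum (𝓞 K), [GL (Fin n) (v.adicCompletion K), glInt n (v.adicCompletion K)])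
    (i j : Fin n) : FiniteAdeleRing (𝓞 K) K :=
  RestrictedProduct.mk (fun v => (((x v)⁻¹ : GL (Fin n) (v.adicCompletion K)) :
      Matrix (Fin n) (Fin n) (v.adicCompletion K)) i j) (by
    filter_upwards [x.eventually] with v hv
    exact (GLn.entries_mem_of_mem_glInt v hv).2 i j)

/-- Components of `GLn.entryAdele`. [folklore] -/
@[simp] theorem GLn.entryAdele_apply
    (x : Πʳ v : HeightOneSpectrum (𝓞 K), [GL (Fin n) (v.adicCompletion K), glInt n (v.adicCompletion K)])
    (i j : Fin n) (v : HeightOneSpectrum (𝓞 K)) :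
    GLn.entryAdele x i j v = (x v : Matrix (Fin n) (Fin n) (v.adicCompletion K)) i j := rfl

/-- Components of `GLn.entryAdeleInv`. [folklore] -/
@[simp] theorem GLn.entryAdeleInv_apply
    (x : Πʳ v : HeightOneSpectrum (𝓞 K), [GL (Fin n) (v.adicCompletion K), glInt n (v.adicCompletion K)])
    (i j : Fin n) (v : HeightOneSpectrum (𝓞 K)) :
    GLn.entryAdeleInv x i j v = (((x v)⁻¹ : GL (Fin n) (v.adicCompletion K)) :
      Matrix (Fin n) (Fin n) (v.adicCompletion K)) i j := rfl

/-- **`Πʳ_v [GL_n(K_v), GL_n(𝒪_v)] → GL_n(𝔸_K^∞)`**: assemble the entries of the local matrices and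
of their inverses into finite adeles. [folklore] -/
def GLn.ofRestrictedPi
    (x : Πʳ v : HeightOneSpectrum (𝓞 K), [GL (Fin n) (v.adicCompletion K), glInt n (v.adicCompletion K)]) :
    GL (Fin n) (FiniteAdeleRing (𝓞 K) K) where
  val := Matrix.of fun i j => GLn.entryAdele x i j
  inv := Matrix.of fun i j => GLn.entryAdeleInv x i j
  val_inv := by
    refine Matrix.ext fun i j => FiniteAdeleRing.ext K fun v => ?_
    change AdelicGroupData.finiteAdeleEval K v _ = AdelicGroupData.finiteAdeleEval K v _
    have h1 : AdelicGroupData.finiteAdeleEval K v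
        (((Matrix.of fun i j => GLn.entryAdele x i j) * Matrix.of fun i j => GLn.entryAdeleInv x i j) i j) =
        ((x v : Matrix (Fin n) (Fin n) (v.adicCompletion K)) *
          (((x v)⁻¹ : GL (Fin n) (v.adicCompletion K)) : Matrix (Fin n) (Fin n) (v.adicCompletion K))) i j := by
      rw [Matrix.mul_apply, Matrix.mul_apply, map_sum]
      refine Finset.sum_congr rfl fun k _ => ?_
      rw [map_mul]
      rfl
    rw [h1, Units.mul_inv, Matrix.one_apply, Matrix.one_apply]
    split_ifs
    · exact (map_one _).symm
    · exact (map_zero _).symm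
  inv_val := by
    refine Matrix.ext fun i j => FiniteAdeleRing.ext K fun v => ?_
    change AdelicGroupData.finiteAdeleEval K v _ = AdelicGroupData.finiteAdeleEval K v _
    have h1 : AdelicGroupData.finiteAdeleEval K v
        (((Matrix.of fun i j => GLn.entryAdeleInv x i j) * Matrix.of fun i j => GLn.entryAdele x i j) i j) =
        ((((x v)⁻¹ : GL (Fin n) (v.adicCompletion K)) : Matrix (Fin n) (Fin n) (v.adicCompletion K)) *
          (x v : Matrix (Fin n) (Fin n) (v.adicCompletion K))) i j := by
      rw [Matrix.mul_apply, Matrix.mul_apply, map_sum]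
      refine Finset.sum_congr rfl fun k _ => ?_
      rw [map_mul]
      rfl
    rw [h1, Units.inv_mul, Matrix.one_apply, Matrix.one_apply]
    split_ifs
    · exact (map_one _).symm
    · exact (map_zero _).symm

/-- Entries of `GLn.ofRestrictedPi x`: `v ↦ (x_v)_{ij}`. [folklore] -/
@[simp] theorem GLn.coe_ofRestrictedPi_apply
    (x : Πʳ v : HeightOneSpectrum (𝓞 K), [GL (Fin n) (v.adicCompletion K), glInt n (v.adicCompletion K)])
    (i j : Fin n) :
    (GLn.ofRestrictedPi x : Matrix (Fin n) (Fin n) (FiniteAdeleRing (𝓞 K) K)) i j = GLn.entryAdele x i j := rfl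

variable (n K)

/-- **`GL_n(𝔸_K^∞) ≃* Πʳ_v [GL_n(K_v), GL_n(𝒪_v)]`** (Borel–Jacquet (1979), §4.1:
`G(𝔸_f) = ∏'_v G(K_v)` restricted with respect to the `G(𝒪_v)`). [cite: BorelJacquet1979, §4.1] -/
def GLn.restrictedPiEquiv : GL (Fin n) (FiniteAdeleRing (𝓞 K) K) ≃*
    Πʳ v : HeightOneSpectrum (𝓞 K), [GL (Fin n) (v.adicCompletion K), glInt n (v.adicCompletion K)] :=
  { GLn.toRestrictedPi n K with
    invFun := GLn.ofRestrictedPi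
    left_inv := fun _ => Units.ext (Matrix.ext fun _ _ => FiniteAdeleRing.ext K fun _ => rfl)
    right_inv := fun _ => RestrictedProduct.ext _ _ fun _ => Units.ext (Matrix.ext fun _ _ => rfl) }

variable {n K}

/-- `GLn.restrictedPiEquiv` is `GLn.toRestrictedPi` (definitional). [folklore] -/
@[simp] theorem GLn.restrictedPiEquiv_apply (y : GL (Fin n) (FiniteAdeleRing (𝓞 K) K)) :
    GLn.restrictedPiEquiv n K y = GLn.toRestrictedPi n K y := rfl

/-- The inverse of `GLn.restrictedPiEquiv` is `GLn.ofRestrictedPi` (definitional). [folklore] -/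
@[simp] theorem GLn.restrictedPiEquiv_symm_apply
    (x : Πʳ v : HeightOneSpectrum (𝓞 K), [GL (Fin n) (v.adicCompletion K), glInt n (v.adicCompletion K)]) :
    (GLn.restrictedPiEquiv n K).symm x = GLn.ofRestrictedPi x := rfl

/-- Components of `GLn.restrictedPiEquiv y`: `GLn.evalAt v y`. [folklore] -/
theorem GLn.restrictedPiEquiv_apply_apply (y : GL (Fin n) (FiniteAdeleRing (𝓞 K) K)) (v : HeightOneSpectrum (𝓞 K)) :
    GLn.restrictedPiEquiv n K y v = GLn.evalAt n K v y := rfl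

/-- `GLn.evalAt v (e.symm x) = x_v`. [folklore] -/
@[simp] theorem GLn.evalAt_restrictedPiEquiv_symm
    (x : Πʳ v : HeightOneSpectrum (𝓞 K), [GL (Fin n) (v.adicCompletion K), glInt n (v.adicCompletion K)])
    (v : HeightOneSpectrum (𝓞 K)) :
    GLn.evalAt n K v ((GLn.restrictedPiEquiv n K).symm x) = x v := by
  have h := congrArg (fun z => z v) ((GLn.restrictedPiEquiv n K).apply_symm_apply x)
  exact h

/-! ### 3. The isomorphism is a homeomorphism -/

section Topology

/-- **A group homomorphism between topological groups mapping neighbourhoods of `1` onto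
neighbourhoods of `1` is an open map** (translate). [folklore] -/
theorem MonoidHom.isOpenMap_of_image_mem_nhds_one {G H : Type*} [Group G] [TopologicalSpace G]
    [IsTopologicalGroup G] [Group H] [TopologicalSpace H] [IsTopologicalGroup H] (f : G →* H)
    (h : ∀ N ∈ 𝓝 (1 : G), f '' N ∈ 𝓝 (1 : H)) : IsOpenMap f := by
  refine isOpenMap_iff_nhds_le.2 fun x U hU => ?_
  rw [Filter.mem_map] at hU
  have hN : (fun g => x * g) ⁻¹' (f ⁻¹' U) ∈ 𝓝 (1 : G) := by
    have hc : Continuous fun g : G => x * g := continuous_const.mul continuous_id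
    refine hc.continuousAt.preimage_mem_nhds ?_
    rwa [mul_one]
  have h1 := h _ hN
  have h2 : (fun h' => f x * h') '' (f '' ((fun g => x * g) ⁻¹' (f ⁻¹' U))) ∈ 𝓝 (f x) := by
    have h3 := (Homeomorph.mulLeft (f x)).isOpenMap.image_mem_nhds h1
    rw [Homeomorph.coe_mulLeft] at h3
    dsimp only at h3
    rwa [mul_one] at h3
  refine Filter.mem_of_superset h2 ?_
  rintro _ ⟨_, ⟨g, hg, rfl⟩, rfl⟩
  change f x * f g ∈ U
  rw [← map_mul]
  exact hg

variable (n K)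

/-- **Membership in `GL_n(𝒪̂_K)` is integrality of every local component.** [folklore] -/
theorem GLn.mem_glFiniteIntegralLevel_iff_forall_evalAt (y : GL (Fin n) (FiniteAdeleRing (𝓞 K) K)) :
    y ∈ glFiniteIntegralLevel n K ↔ ∀ v, GLn.evalAt n K v y ∈ glInt n (v.adicCompletion K) := by
  simp only [mem_glFiniteIntegralLevel_iff, mem_integralFiniteAdeles_iff, GLn.evalAt_mem_glInt_iff]
  exact ⟨fun h v => ⟨fun i j => h.1 i j v, fun i j => h.2 i j v⟩,
    fun h => ⟨fun i j v => (h v).1 i j, fun i j v => (h v).2 i j⟩⟩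

/-- **The local components on `GL_n(𝒪̂_K)`**: `GL_n(𝒪̂_K) → ∏_v GL_n(𝒪_v)`, `k ↦ (k_v)_v`. [folklore] -/
def GLn.integralComponents (k : glFiniteIntegralLevel n K) (v : HeightOneSpectrum (𝓞 K)) :
    glInt n (v.adicCompletion K) :=
  ⟨GLn.evalAt n K v k, (GLn.mem_glFiniteIntegralLevel_iff_forall_evalAt n K k).1 k.2 v⟩

variable {n K}

/-- On `GL_n(𝒪̂_K)`, `GLn.toRestrictedPi` is the structure map of the restricted product applied to
the local components. [folklore] -/
theorem GLn.toRestrictedPi_coe_eq_structureMap (k : glFiniteIntegralLevel n K) :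
    GLn.toRestrictedPi n K k =
      RestrictedProduct.structureMap (fun v : HeightOneSpectrum (𝓞 K) => GL (Fin n) (v.adicCompletion K))
        (fun v => ((glInt n (v.adicCompletion K) : Subgroup _) : Set (GL (Fin n) (v.adicCompletion K)))) cofinite
        (GLn.integralComponents n K k) :=
  RestrictedProduct.ext _ _ fun _ => rfl

/-- The local components map `GL_n(𝒪̂_K) → ∏_v GL_n(𝒪_v)` is continuous. [folklore] -/
theorem GLn.continuous_integralComponents : Continuous (GLn.integralComponents n K) :=
  continuous_pi fun v => ((GLn.continuous_evalAt v).comp continuous_subtype_val).subtype_mk _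

/-- The local components map `GL_n(𝒪̂_K) → ∏_v GL_n(𝒪_v)` is bijective (it is the isomorphism
`GLn.restrictedPiEquiv` on `GL_n(𝒪̂_K) = e⁻¹(∏_v GL_n(𝒪_v))`). [folklore] -/
theorem GLn.bijective_integralComponents : Function.Bijective (GLn.integralComponents n K) := by
  refine ⟨fun k k' h => Subtype.ext ((GLn.restrictedPiEquiv n K).injective ?_), fun f => ?_⟩
  · refine RestrictedProduct.ext _ _ fun v => ?_
    exact congrArg Subtype.val (congrFun h v)
  · let x : Πʳ v : HeightOneSpectrum (𝓞 K), [GL (Fin n) (v.adicCompletion K), glInt n (v.adicCompletion K)] :=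
      RestrictedProduct.structureMap _ _ cofinite f
    have hy : (GLn.restrictedPiEquiv n K).symm x ∈ glFiniteIntegralLevel n K := by
      rw [GLn.mem_glFiniteIntegralLevel_iff_forall_evalAt]
      intro v
      rw [GLn.evalAt_restrictedPiEquiv_symm]
      exact (f v).2
    refine ⟨⟨_, hy⟩, funext fun v => Subtype.ext ?_⟩
    change GLn.evalAt n K v ((GLn.restrictedPiEquiv n K).symm x) = f v
    rw [GLn.evalAt_restrictedPiEquiv_symm]
    rfl

/-- **`GLn.toRestrictedPi` is continuous** (on the open subgroup `GL_n(𝒪̂_K)` it is the structure map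
composed with the continuous local components map; a homomorphism of topological groups continuous
at `1` is continuous). [folklore] -/
theorem GLn.continuous_toRestrictedPi : Continuous (GLn.toRestrictedPi n K) := by
  haveI : Fact (∀ v : HeightOneSpectrum (𝓞 K),
      IsOpen (((glInt n (v.adicCompletion K) : Subgroup _) : Set (GL (Fin n) (v.adicCompletion K))))) :=
    ⟨fun v => isOpen_glInt n (v.adicCompletion K)⟩
  have hOn : ContinuousOn (GLn.toRestrictedPi n K) (glFiniteIntegralLevel n K : Set _) := by
    rw [continuousOn_iff_continuous_restrict]
    have hfun : (glFiniteIntegralLevel n K : Set (GL (Fin n) (FiniteAdeleRing (𝓞 K) K))).restrict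
        (GLn.toRestrictedPi n K) =
        fun k : glFiniteIntegralLevel n K => RestrictedProduct.structureMap
          (fun v : HeightOneSpectrum (𝓞 K) => GL (Fin n) (v.adicCompletion K))
          (fun v => ((glInt n (v.adicCompletion K) : Subgroup _) : Set (GL (Fin n) (v.adicCompletion K)))) cofinite
          (GLn.integralComponents n K k) :=
      funext fun k => GLn.toRestrictedPi_coe_eq_structureMap k
    rw [hfun]
    exact RestrictedProduct.isEmbedding_structureMap.continuous.comp GLn.continuous_integralComponents
  have hAt : ContinuousAt (GLn.toRestrictedPi n K) 1 :=
    hOn.continuousAt ((isOpen_glFiniteIntegralLevel n K).mem_nhds (one_mem _))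
  exact continuous_of_continuousAt_one (GLn.toRestrictedPi n K) hAt

/-- **`GLn.toRestrictedPi` is an open map**: `GL_n(𝒪̂_K)` is compact (`isCompact_glFiniteIntegralLevel_holds`)
and `∏_v GL_n(𝒪_v)` is Hausdorff, so the continuous bijection between them is a homeomorphism, and
the structure map `∏_v GL_n(𝒪_v) → Πʳ_v` is an open embedding; hence neighbourhoods of `1` go to
neighbourhoods of `1`. [folklore] -/
theorem GLn.isOpenMap_toRestrictedPi : IsOpenMap (GLn.toRestrictedPi n K) := by
  haveI : Fact (∀ v : HeightOneSpectrum (𝓞 K),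
      IsOpen (((glInt n (v.adicCompletion K) : Subgroup _) : Set (GL (Fin n) (v.adicCompletion K))))) :=
    ⟨fun v => isOpen_glInt n (v.adicCompletion K)⟩
  haveI : CompactSpace (glFiniteIntegralLevel n K) :=
    isCompact_iff_compactSpace.mp (isCompact_glFiniteIntegralLevel_holds n K)
  -- the homeomorphism `GL_n(𝒪̂_K) ≃ₜ ∏_v GL_n(𝒪_v)`
  let ψ : glFiniteIntegralLevel n K ≃ₜ ((v : HeightOneSpectrum (𝓞 K)) → glInt n (v.adicCompletion K)) :=
    Continuous.homeoOfEquivCompactToT2 (f := Equiv.ofBijective _ (GLn.bijective_integralComponents (n := n) (K := K)))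
      (by exact GLn.continuous_integralComponents)
  have hψ : ∀ k, ψ k = GLn.integralComponents n K k := fun _ => rfl
  have hsM := RestrictedProduct.isOpenEmbedding_structureMap
    (R := fun v : HeightOneSpectrum (𝓞 K) => GL (Fin n) (v.adicCompletion K))
    (A := fun v => ((glInt n (v.adicCompletion K) : Subgroup _) : Set (GL (Fin n) (v.adicCompletion K))))
    fun v => isOpen_glInt n (v.adicCompletion K)
  refine MonoidHom.isOpenMap_of_image_mem_nhds_one _ fun N hN => ?_
  -- `N ∩ GL_n(𝒪̂_K)` seen in the subtype is a neighbourhood of `1`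
  have hN' : Subtype.val ⁻¹' N ∈ 𝓝 (1 : glFiniteIntegralLevel n K) :=
    continuous_subtype_val.continuousAt.preimage_mem_nhds hN
  have h1 : ψ '' (Subtype.val ⁻¹' N) ∈ 𝓝 (ψ 1) := ψ.isOpenMap.image_mem_nhds hN'
  have h2 := hsM.isOpenMap.image_mem_nhds h1
  have hone : RestrictedProduct.structureMap
      (fun v : HeightOneSpectrum (𝓞 K) => GL (Fin n) (v.adicCompletion K))
      (fun v => ((glInt n (v.adicCompletion K) : Subgroup _) : Set (GL (Fin n) (v.adicCompletion K)))) cofinite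
      (ψ 1) = 1 := by
    rw [hψ, ← GLn.toRestrictedPi_coe_eq_structureMap, OneMemClass.coe_one, map_one]
  rw [hone] at h2
  refine Filter.mem_of_superset h2 ?_
  rintro _ ⟨_, ⟨k, hk, rfl⟩, rfl⟩
  refine ⟨k, hk, ?_⟩
  rw [hψ, ← GLn.toRestrictedPi_coe_eq_structureMap]

variable (n K)

/-- **`GL_n(𝔸_K^∞) ≃ₜ Πʳ_v [GL_n(K_v), GL_n(𝒪_v)]`**: the group isomorphism `GLn.restrictedPiEquiv` is a
homeomorphism (Borel–Jacquet (1979), §4.1). [cite: BorelJacquet1979, §4.1] -/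
def GLn.restrictedPiHomeomorph : GL (Fin n) (FiniteAdeleRing (𝓞 K) K) ≃ₜ
    Πʳ v : HeightOneSpectrum (𝓞 K), [GL (Fin n) (v.adicCompletion K), glInt n (v.adicCompletion K)] where
  toEquiv := (GLn.restrictedPiEquiv n K).toEquiv
  continuous_toFun := GLn.continuous_toRestrictedPi
  continuous_invFun := by
    refine continuous_def.2 fun U hU => ?_
    have h : (GLn.restrictedPiEquiv n K).toEquiv.symm ⁻¹' U = GLn.toRestrictedPi n K '' U := by
      rw [← Equiv.image_eq_preimage_symm]
      rfl
    change IsOpen ((GLn.restrictedPiEquiv n K).toEquiv.symm ⁻¹' U)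
    rw [h]
    exact GLn.isOpenMap_toRestrictedPi U hU

variable {n K}

/-- `GLn.restrictedPiHomeomorph` is `GLn.toRestrictedPi` (definitional). [folklore] -/
@[simp] theorem GLn.restrictedPiHomeomorph_apply (y : GL (Fin n) (FiniteAdeleRing (𝓞 K) K)) :
    GLn.restrictedPiHomeomorph n K y = GLn.toRestrictedPi n K y := rfl

/-- The inverse of `GLn.restrictedPiHomeomorph` is `GLn.ofRestrictedPi` (definitional). [folklore] -/
@[simp] theorem GLn.restrictedPiHomeomorph_symm_apply
    (x : Πʳ v : HeightOneSpectrum (𝓞 K), [GL (Fin n) (v.adicCompletion K), glInt n (v.adicCompletion K)]) :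
    (GLn.restrictedPiHomeomorph n K).symm x = GLn.ofRestrictedPi x := rfl

/-- **The inverse isomorphism `Πʳ_v [GL_n(K_v), GL_n(𝒪_v)] →* GL_n(𝔸_K^∞)` is continuous.** [folklore] -/
theorem GLn.continuous_restrictedPiEquiv_symm : Continuous (GLn.restrictedPiEquiv n K).symm :=
  (GLn.restrictedPiHomeomorph n K).symm.continuous

/-- **The inverse isomorphism `Πʳ_v [GL_n(K_v), GL_n(𝒪_v)] →* GL_n(𝔸_K^∞)` is open.** [folklore] -/
theorem GLn.isOpenMap_restrictedPiEquiv_symm : IsOpenMap (GLn.restrictedPiEquiv n K).symm :=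
  (GLn.restrictedPiHomeomorph n K).symm.isOpenMap

end Topology


end Literature.NumberTheory.Automorphic
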